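import Summits.FinalStateConjecture.FinalStateConjecture.Theses.StarvedNecks
import Summits.FinalStateConjecture.FinalStateConjecture.Theses.TangentConeAtIPlus
import HarnessLib

/-!
# Retype kit (line lead, 2026-08-17) — crux stmt-FinalStateConjecture-17575 `Theses.StarvedNecks.HonestFixedRadiusSettlingT`
# restated WITHOUT the rays conjunct, and the route's deciding theorem re-wired through item 17673

For the tenure planner of route StarvedNecks (rev 11).  Kernel-checked against the CURRENT route file:

* `HonestFixedRadiusSettlingTnr` — the text of item 17575 with the single conjunct
  `RaysStayInClosure 𝒟.toCauchyDevelopment O ∧` deleted (nothing else touched): the candidate restatement (card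
  `rays-see-only-o`; lead skeleton `Lines/Sketch.lean`, stub `stub_core`).
* `honestFixedRadiusSettlingT_of_tnr` — T ⇐ Tnr + `NecksCertifyR` + `SeamedChartsExhaust` + `FutureOrientedOfSeamed` +
  `TangentConeAtIPlus.SettledExteriorHoldsRays` (same proof as the landed/proposed Theorems lever
  `Theorems.StarvedNecks.Rayless.honestFixedRadiusSettlingT_of_rayless`).
* `closesRayless` — the deciding theorem of a rev in which 17575 is restated as `HonestFixedRadiusSettlingTnr` and 17673 is
  wanted by StarvedNecks: `Tnr → NeckGapDecay → GapDecaySuffices → SeamedChartsExhaust → FutureOrientedOfSeamed →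
  SettledExteriorHoldsRays → FinalStateConjecture`, proved from the current `closes` (no other item changes).

CAVEAT for the planner (truth, not typing): the generic rays clause of T is WEAKER than the ∀-datum item 17673; the re-wire
makes the route depend on 17673, which a single admissible datum with a future-complete hidden null ray falsifies (BN-4-4 on
`M # ℝ³` hits both forms; on `ℝ³` a non-generic complete interior ray would kill 17673 but not T).  The kit shows the re-wire
is POSSIBLE and mechanical; whether it is wise is the planner's call (see PICKED.md / NOTES of the lead).
-/

set_option linter.dupNamespace false

noncomputable section

open scoped Manifold ContDiff ENNReal Topology
open Filter Set Function Literature.Geometry.Lorentzian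

namespace Summit.FinalStateConjecture.FinalStateConjecture.Cruxes.HonestFixedRadiusSettlingT.RetypeKitRayless

/-- **Tnr** — item 17575 `HonestFixedRadiusSettlingT` with the conjunct `RaysStayInClosure 𝒟.toCauchyDevelopment O ∧`
deleted: for every admissible `3`-manifold `X`, tame-Christodoulou-generically in `admissibleVacuumData X`, the datum has
an MGHD and every MGHD `𝒟` has complete `𝓘⁺` and admits `(O, d, R₀)`, a `C⁴` `FinalStateDecomposition` `d` of
`O = exteriorOf 𝒟 d.charted` with HonestCore`(d, R₀)`, HonestFar`(d, R₀)` and pairwise distinct asymptotic four-velocities. -/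
def HonestFixedRadiusSettlingTnr : Prop :=
  open Literature.Geometry.Lorentzian in open scoped ContDiff ENNReal in let Hc := ( fun (𝓢 : Spacetime.{0} 4) (O : Set 𝓢.carrier) (k : ℕ) (d : FinalStateDecomposition 𝓢 O k) (R₀ : ℝ) => let B := d.background; let t := fun i ↦ (B i).time; let r := fun i ↦ (B i).radius; let Ψ := d.chart; (∀ i, Kerr.IsSubextremal (d.mass i) (d.spin i) ∧ 100 * d.mass i ≤ R₀ ∧ 0 < ((d.motion i).1 : E4 ≃L[ℝ] E4) (E4.basisVector 0) 0) ∧ (∀ i (ϱ τ₂ : ℝ), R₀ ≤ ϱ → d.τ₀ < τ₂ → Ψ i '' {x | d.τ₀ < t i x.1 ∧ t i x.1 < τ₂ ∧ r i x.1 < ϱ} ⊆ 𝓢.metric.causalPast 𝓢.timeOrientation (Ψ i '' (B i).truncTimeSlab ϱ τ₂)) ∧ (∀ i (τ' : ℝ) (ϱ : ℝ → ℝ), Continuous ϱ → d.τ₀ < τ' → let A := Ψ i '' {x | τ' ≤ t i x.1 ∧ r i x.1 ≤ ϱ (t i x.1)}; closure A ∩ O ⊆ A) ∧ (∀ y : d.flatDomain,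 d.τ₀ < y.1 0 → 𝓢.timeOrientation.IsFutureDirected (mfderiv 𝓘(ℝ, E4) (𝓡 4) d.flatChart y (E4.basisVector 0))) ); let Hf := ( fun (𝓢 : Spacetime.{0} 4) (O : Set 𝓢.carrier) (k : ℕ) (d : FinalStateDecomposition 𝓢 O k) (R₀ : ℝ) => let B := d.background; let t := fun i ↦ (B i).time; let r := fun i ↦ (B i).radius; let Φ := d.flatChart; (∀ τ₂ : ℝ, d.τ₀ < τ₂ → Φ '' {y | d.τ₀ < y.1 0 ∧ y.1 0 < τ₂} ⊆ 𝓢.metric.causalPast 𝓢.timeOrientation (Φ '' (Minkowski.backgroundOn d.flatDomain).timeSlab τ₂)) ∧ (∀ τ' : ℝ, d.τ₀ < τ' → closure (Φ '' {y | τ' ≤ y.1 0 ∧ ∀ i, d.excision i (y.1 0) + 1 ≤ r i y.1}) ⊆ Φ '' {y | τ' ≤ y.1 0}) ∧ (∀ i, ∃ T : ℝ, supCkENorm (Subtype.val '' {x : (B i).domain | T ≤ t i x.1 ∧ R₀ ≤ r i x.1 ∧ ∀ j, j ≠ i → r i x.1 ≤ r j x.1}) 0 (𝓢.deviationExtend (B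 i) (d.chart i)) ≤ ENNReal.ofReal (1 / (10 * ‖(((d.motion i).1 : E4 ≃L[ℝ] E4) : E4 →L[ℝ] E4)‖ ^ 2))) ); ∀ (X : Type) [TopologicalSpace X] [ChartedSpace E3 X] [IsManifold (𝓡 3) ∞ X] [T2Space X] [SecondCountableTopology X] [ConnectedSpace X], InitialDataSet.IsTameChristodoulouGeneric (admissibleVacuumData X) (fun D ↦ (∃ 𝒟 : VacuumCauchyDevelopment D, 𝒟.IsMaximal) ∧ ∀ 𝒟 : VacuumCauchyDevelopment D, 𝒟.IsMaximal → HasCompleteNullInfinity 𝒟.toCauchyDevelopment ∧ ∃ (O : Set 𝒟.carrier) (d : FinalStateDecomposition 𝒟.toSpacetime O 4) (R₀ : ℝ), O = exteriorOf 𝒟.toCauchyDevelopment d.charted ∧ Hc 𝒟.toSpacetime O 4 d R₀ ∧ Hf 𝒟.toSpacetime O 4 d R₀ ∧ (∀ i j : Fin d.N, i ≠ j → ((d.motion i).1 : E4 ≃L[ℝ] E4) (E4.basisVector 0) ≠ ((d.motion j).1 : E4 ≃L[ℝ] E4) (E4.basisVector 0))) 1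

/-- Tame Christodoulou genericity (codimension `1`) is antitone in the exceptional set. [folklore] -/
theorem mono {X : Type} [TopologicalSpace X] [ChartedSpace E3 X] [IsManifold (𝓡 3) ∞ X]
    {𝓓 : Set (InitialDataSet (𝓡 3) X)} {P Q : InitialDataSet (𝓡 3) X → Prop}
    (hPQ : ∀ D ∈ 𝓓, P D → Q D) (hP : InitialDataSet.IsTameChristodoulouGeneric 𝓓 P 1) :
    InitialDataSet.IsTameChristodoulouGeneric 𝓓 Q 1 := by
  intro d hd
  obtain ⟨e, F, hF, himm, h0, hinj, hmem, hE⟩ := hP d ⟨hd.1, fun h ↦ hd.2 (hPQ d hd.1 h)⟩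
  exact ⟨e, F, hF, himm, h0, hinj, hmem, fun c hc hc' ↦ hE c hc ⟨hc'.1, fun h ↦ hc'.2 (hPQ _ hc'.1 h)⟩⟩

/-- **T ⇐ Tnr + S + E + F + 17673** (the lever of card `rays-see-only-o`), against the route decls by name. -/
theorem honestFixedRadiusSettlingT_of_tnr (h₀ : HonestFixedRadiusSettlingTnr)
    (hS : Theses.StarvedNecks.NecksCertifyR) (hE : Theses.StarvedNecks.SeamedChartsExhaust)
    (hF : Theses.StarvedNecks.FutureOrientedOfSeamed) (hR : Theses.TangentConeAtIPlus.SettledExteriorHoldsRays) :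
    Theses.StarvedNecks.HonestFixedRadiusSettlingT := by
  intro X _ _ _ _ _ _
  refine mono ?_ (h₀ X)
  rintro D hD ⟨hex, hall⟩
  refine ⟨hex, fun 𝒟 h𝒟 ↦ ?_⟩
  obtain ⟨hscri, O, d, R₀, hO, hcore, hfar, hdv⟩ := hall 𝒟 h𝒟
  obtain ⟨d₂, R, R₀', hO₂, hcore₂, hseam⟩ := hS X D hD 𝒟 h𝒟 O d R₀ hO hcore hfar hdv
  exact ⟨hscri, O, d, R₀, hO,
    hR X D hD 𝒟 h𝒟 hscri O d₂ (fun i ↦ (hcore₂.1 i).1) hO₂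
      (hE X D hD 𝒟 h𝒟 O d₂ R R₀' hO₂ hcore₂ hseam) (hF X D hD 𝒟 h𝒟 O d₂ R R₀' hO₂ hcore₂ hseam),
    hcore, hfar, hdv⟩

/-- **The re-wired deciding theorem**: with 17575 restated as `HonestFixedRadiusSettlingTnr` and 17673 wanted by the route,
the summit follows from the current `closes` (rev 11: `G_T → NeckGapDecay → GapDecaySuffices → SeamedChartsExhaust →
FutureOrientedOfSeamed → FinalStateConjecture`). -/
theorem closesRayless (h₁ : HonestFixedRadiusSettlingTnr) (h₂ : Theses.StarvedNecks.NeckGapDecay)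
    (h₃ : Theses.StarvedNecks.GapDecaySuffices) (h₄ : Theses.StarvedNecks.SeamedChartsExhaust)
    (h₅ : Theses.StarvedNecks.FutureOrientedOfSeamed) (h₆ : Theses.TangentConeAtIPlus.SettledExteriorHoldsRays) :
    _root_.FinalStateConjecture :=
  Theses.StarvedNecks.closes (honestFixedRadiusSettlingT_of_tnr h₁ (h₃ h₂) h₄ h₅ h₆) h₂ h₃ h₄ h₅

/-- Sanity: T ⇒ Tnr (the restatement is weaker than the item as filed). -/
theorem tnr_of_T (h : Theses.StarvedNecks.HonestFixedRadiusSettlingT) : HonestFixedRadiusSettlingTnr := by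
  intro X _ _ _ _ _ _
  refine mono ?_ (h X)
  rintro D - ⟨hex, hall⟩
  refine ⟨hex, fun 𝒟 h𝒟 ↦ ?_⟩
  obtain ⟨hscri, O, d, R₀, hO, -, hcore, hfar, hdv⟩ := hall 𝒟 h𝒟
  exact ⟨hscri, O, d, R₀, hO, hcore, hfar, hdv⟩

end Summit.FinalStateConjecture.FinalStateConjecture.Cruxes.HonestFixedRadiusSettlingT.RetypeKitRayless

end
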